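import Mathlib
import Literature.NumberTheory.LFunctions.WeilExplicit
import Literature.NumberTheory.LFunctions.WeilWindowSimpleEven
import Literature.NumberTheory.LFunctions.WeilGroundEnergyParitySplit
import Literature.NumberTheory.LFunctions.WeilOddGroundState

/-!
# Sketch — crux-ideate round 2, ideator k4, crux `EvenWinsBeyondArch` (stmt-RiemannHypothesis-15432)

First lemmas of the two idea cards (statements only; proofs are NOT claimed here):

* card `loewner-secular-parity`: the Loewner/displacement structure of the trigonometric Galerkin
  matrices of ANY windowed form (Connes–van Suijlekom, arXiv:2511.23257, Prop. 4.1/4.2, Lemma 5.1)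
  couples the two parity blocks by an EXACT rank-one identity, so the odd spectrum solves a scalar
  secular equation in even-sector data (`loewnerOddBlock_eq`, `lambdaMin_odd_gt_of_secular`).
* (examined, NOT filed — see NOTES.md `## Barrier notes`) `single-well-symbol`: continuum version of Trench's
  Lemma 1 (LAA 195 (1993) 59–68): a representative symbol of the window form that crosses the ground level only
  once on `(0, ∞)` forbids a repeated bottom, hence a parity tie (`noParityTie_of_singleWellSymbol`) — a TRUE
  criterion whose hypothesis is infeasible for Weil's window form once `ε_od(a) ≪ ν₁^{ev}(a)` (kit j026548 + (★) in NOTES).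
-/

noncomputable section

set_option linter.dupNamespace false
set_option linter.unusedSimpArgs false

open Complex MeasureTheory Set Matrix
open scoped Real BigOperators

namespace Summit.RiemannHypothesis.RiemannHypothesis.Cruxes.EvenWinsBeyondArch.IdeasK4

open Literature.NumberTheory.LFunctions

/-! ## Card `loewner-secular-parity` -/

/-- Index shift `Fin N → ℝ`, `j ↦ j + 1` (the sine/cosine frequencies `1 … N`). -/
def idx {N : ℕ} (j : Fin N) : ℝ := (j : ℕ) + 1

/-- Even block WITHOUT the constant mode of a Loewner window matrix with data `a` (diagonal, even)
and `b` (off-diagonal generator, odd): `A0_{jk} = 2 (j b_j − k b_k)/(j² − k²)` (`j ≠ k`),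
`A0_{jj} = a_j + b_j / j` (cosine basis `(U_j + U_{-j})/√2`, `j = 1..N`). -/
def loewnerEvenBlock (N : ℕ) (a b : ℕ → ℝ) : Matrix (Fin N) (Fin N) ℝ :=
  Matrix.of fun j k ↦
    if j = k then a ((j : ℕ) + 1) + b ((j : ℕ) + 1) / idx j
    else 2 * (idx j * b ((j : ℕ) + 1) - idx k * b ((k : ℕ) + 1)) / (idx j ^ 2 - idx k ^ 2)

/-- Odd block of the same Loewner window matrix: `B_{jk} = 2 (k b_j − j b_k)/(j² − k²)` (`j ≠ k`),
`B_{jj} = a_j − b_j / j` (sine basis `(U_j − U_{-j})/(√2 i)`, `j = 1..N`). -/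
def loewnerOddBlock (N : ℕ) (a b : ℕ → ℝ) : Matrix (Fin N) (Fin N) ℝ :=
  Matrix.of fun j k ↦
    if j = k then a ((j : ℕ) + 1) - b ((j : ℕ) + 1) / idx j
    else 2 * (idx k * b ((j : ℕ) + 1) - idx j * b ((k : ℕ) + 1)) / (idx j ^ 2 - idx k ^ 2)

/-- The frequency weight `J = diag(1, …, N)` and its inverse. -/
def freqDiag (N : ℕ) : Matrix (Fin N) (Fin N) ℝ := Matrix.diagonal fun j ↦ idx j

def freqDiagInv (N : ℕ) : Matrix (Fin N) (Fin N) ℝ := Matrix.diagonal fun j ↦ (idx j)⁻¹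

/-- **FIRST LEMMA (card `loewner-secular-parity`), exact rank-one coupling of the parity sectors.**
For every Loewner window matrix (in particular the trigonometric Galerkin matrix of Weil's window
form, Connes–van Suijlekom Prop. 4.1), the odd block is a diagonal similarity of the constant-free
even block minus a rank-one matrix: `B = J A0 J⁻¹ − u vᵀ`, `u_j = 2 b_j`, `v_k = 1/k`.
(Entrywise identity; checked by hand in NOTES.md, numerically in kit j026522.) -/
theorem loewnerOddBlock_eq (N : ℕ) (a b : ℕ → ℝ) :
    loewnerOddBlock N a b =
      freqDiag N * loewnerEvenBlock N a b * freqDiagInv N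
        - Matrix.vecMulVec (fun j : Fin N ↦ 2 * b ((j : ℕ) + 1)) (fun k : Fin N ↦ (idx k)⁻¹) := by
  ext j k
  have hj : (0 : ℝ) < idx j := by unfold idx; positivity
  have hk : (0 : ℝ) < idx k := by unfold idx; positivity
  simp only [loewnerOddBlock, loewnerEvenBlock, freqDiag, freqDiagInv, Matrix.sub_apply,
    Matrix.mul_apply, Matrix.diagonal_apply, Matrix.of_apply, Matrix.vecMulVec_apply]
  by_cases hjk : j = k
  · subst hjk
    simp only [if_true]
    rw [Finset.sum_eq_single j, Finset.sum_eq_single j]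
    · simp only [if_true]
      field_simp
      ring
    · intro i _ hi; simp [hi, Ne.symm hi]
    · intro h; exact absurd (Finset.mem_univ _) h
    · intro i _ hi; simp [hi, Ne.symm hi]
    · intro h; exact absurd (Finset.mem_univ _) h
  · have hne : idx j ≠ idx k := by
      unfold idx
      intro h
      apply hjk
      ext
      exact_mod_cast (add_right_cancel h : ((j : ℕ) : ℝ) = (k : ℕ))
    have hsum : idx j ^ 2 - idx k ^ 2 ≠ 0 := by
      intro h
      have : (idx j - idx k) * (idx j + idx k) = 0 := by nlinarith [h]
      rcases mul_eq_zero.1 this with h1 | h2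
      · exact hne (by linarith)
      · linarith
    simp only [hjk, if_false]
    rw [Finset.sum_eq_single k, Finset.sum_eq_single j]
    · simp only [if_true, hjk, if_false]
      field_simp
      ring
    · intro i _ hi; simp [hi, Ne.symm hi]
    · intro h; exact absurd (Finset.mem_univ _) h
    · intro i _ hi; simp [hi, Ne.symm hi]
    · intro h; exact absurd (Finset.mem_univ _) h

/-- **Secular criterion (card `loewner-secular-parity`).** If below a level `t` the constant-free
even block stays positive definite after the shift and the secular function
`F(μ) = 𝟙ᵀ (A0 − μ)⁻¹ w`, `w_j = 2 b_j / j`, stays below `1`, then every eigenvalue of the odd block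
lies above `t` (no odd eigenvalue — in particular not the odd bottom — at or below `t`).
With `t :=` the even bottom this is "even wins strictly at Galerkin level `N`". -/
theorem lambdaMin_odd_gt_of_secular (N : ℕ) (a b : ℕ → ℝ) (t : ℝ)
    (hpos : ∀ μ ≤ t, (loewnerEvenBlock N a b - μ • (1 : Matrix (Fin N) (Fin N) ℝ)).PosDef)
    (hsec : ∀ μ ≤ t,
      dotProduct (fun _ ↦ (1 : ℝ))
        ((loewnerEvenBlock N a b - μ • (1 : Matrix (Fin N) (Fin N) ℝ))⁻¹ *ᵥ
          fun j ↦ 2 * b ((j : ℕ) + 1) / idx j) < 1)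
    (hB : (loewnerOddBlock N a b).IsHermitian) :
    ∀ i, t < hB.eigenvalues i := by
  sorry

/-- FULL even block (constant mode included; index `0` = the normalised constant `U_0`, index `j ≥ 1` =
cosine of frequency `j`): `A_{00} = a_0`, `A_{0j} = √2 b_j / j`, `A_{jk}` as in `loewnerEvenBlock`. -/
def loewnerEvenBlockFull (N : ℕ) (a b : ℕ → ℝ) : Matrix (Fin (N + 1)) (Fin (N + 1)) ℝ :=
  Matrix.of fun i j ↦
    if (i : ℕ) = 0 ∧ (j : ℕ) = 0 then a 0
    else if (i : ℕ) = 0 then Real.sqrt 2 * b j / (j : ℕ)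
    else if (j : ℕ) = 0 then Real.sqrt 2 * b i / (i : ℕ)
    else if i = j then a i + b i / (i : ℕ)
    else 2 * ((i : ℕ) * b i - (j : ℕ) * b j) / (((i : ℕ) : ℝ) ^ 2 - ((j : ℕ) : ℝ) ^ 2)

/-- The normalised constant mode `c_0` and the even EDGE vector `η = Σ_n U_n` (`= √L ·` Dirac mass at the
window edge) in the cosine basis: `η = c_0 + √2 Σ_{j ≥ 1} c_j`. -/
def constMode (N : ℕ) : Fin (N + 1) → ℝ := fun i ↦ if (i : ℕ) = 0 then 1 else 0

def edgeVec (N : ℕ) : Fin (N + 1) → ℝ := fun i ↦ if (i : ℕ) = 0 then 1 else Real.sqrt 2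

/-- **FIRST LEMMA, main form (card `loewner-secular-parity`): the odd spectrum is the zero set of ONE
scalar function of even-sector data.**  From Connes–van Suijlekom's displacement identity
`D Q − Q D = |β⟩⟨η| − |η⟩⟨β|` (Lemma 5.1) restricted to odd vectors: `A (D g) = D (B g) + ⟨β, g⟩ η`, so for
`μ ∉ spec A`:  `μ ∈ spec B  ↔  G(μ) := ⟨c_0, (A − μ)⁻¹ η⟩ = 0`, where
`G(μ) = Σ_k mean(f_k)·edge(f_k)/(ν_k − μ)` over the orthonormal even eigenmodes `f_k` (`Σ_k mean·edge = 1`).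
(Numerically: zeros of `G` = odd eigenvalues to 1e-27, kit j026522/j026565.) -/
theorem oddEigenvalue_iff_G_eq_zero (N : ℕ) (a b : ℕ → ℝ) (μ : ℝ)
    (hμ : (loewnerEvenBlockFull N a b - μ • (1 : Matrix (Fin (N + 1)) (Fin (N + 1)) ℝ)).det ≠ 0) :
    (∃ g : Fin N → ℝ, g ≠ 0 ∧ loewnerOddBlock N a b *ᵥ g = μ • g) ↔
      dotProduct (constMode N)
        ((loewnerEvenBlockFull N a b - μ • (1 : Matrix (Fin (N + 1)) (Fin (N + 1)) ℝ))⁻¹ *ᵥ edgeVec N)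
        = 0 := by
  sorry

/-- **MEAN–EDGE SIGN COHERENCE ⇒ EVEN WINS (card `loewner-secular-parity`, the RH-bearing input in its
cleanest finite form).**  If every even eigenmode has `mean · edge ≥ 0` and the even ground modes have
`mean · edge > 0`, then `G > 0` on `(−∞, ν_0)` and no tie can occur at `ν_0`, so every odd eigenvalue
lies strictly above the even bottom (indeed the two spectra interlace when all weights are `> 0`). -/
theorem evenBottom_lt_odd_of_meanEdgeCoherent (N : ℕ) (a b : ℕ → ℝ)
    (hA : (loewnerEvenBlockFull N a b).IsHermitian) (hB : (loewnerOddBlock N a b).IsHermitian)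
    (hcoh : ∀ (v : Fin (N + 1) → ℝ) (ν : ℝ), loewnerEvenBlockFull N a b *ᵥ v = ν • v →
      0 ≤ dotProduct (constMode N) v * dotProduct (edgeVec N) v)
    (hground : ∀ (v : Fin (N + 1) → ℝ), v ≠ 0 →
      loewnerEvenBlockFull N a b *ᵥ v = (⨅ i, hA.eigenvalues i) • v →
      0 < dotProduct (constMode N) v * dotProduct (edgeVec N) v) :
    ∀ j, (⨅ i, hA.eigenvalues i) < hB.eigenvalues j := by
  sorry

/-! ## Card `single-well-symbol` -/

/-- `σ` is a representative SYMBOL of Weil's window-`a` form: for every test function on the window,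
`Re Q(g) = ∫ |ĝ(½ + iτ)|² σ(τ) dτ` (with the integrand integrable). Representatives differ by even
tempered distributions whose Fourier transform vanishes on `(−2a, 2a)`; the geometric side gives one
(`(1/2π) Re ψ(¼ + iτ/2) − log π/…` + truncated pole kernel − `(1/π) Σ_{m ≤ e^{2a}} Λ(m) m^{-1/2} cos(τ log m)`),
and under RH the zero-counting measure is another (not a function). -/
def IsWindowSymbol (a : ℝ) (σ : ℝ → ℝ) : Prop :=
  Measurable σ ∧ ∀ g : ℝ → ℂ, IsWeilTest g → tsupport g ⊆ Icc (-a) a →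
    Integrable (fun τ : ℝ ↦ ‖weilMellin g (1 / 2 + τ * I)‖ ^ 2 * σ τ) ∧
    (weilQuadratic g).re = ∫ τ : ℝ, ‖weilMellin g (1 / 2 + τ * I)‖ ^ 2 * σ τ

/-- **FIRST LEMMA (card `single-well-symbol`), continuum Trench lemma.** If the window-`a` form admits
an even representative symbol that lies below the ground level `ε(a)` exactly on a central interval
`|τ| < τ₀` and above it outside (strictly on sets of positive measure on both sides), then the bottom
of the window form is not a parity tie: `ε_ev(a) ≠ ε_od(a)`.  (Trench 1993, Lemma 1, transplanted
from real symmetric Toeplitz matrices to the window form: a tie gives an even and an odd ground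
state `X, Y`; `Z = αX + βY` with `Ẑ(±τ₀) = 0`; `W := Z / (τ² − τ₀²)` is again a window function and the
Euler–Lagrange relation forces `∫ (σ − ε)(τ² − τ₀²)|Ŵ|² = 0` with a nonnegative, nonzero integrand.) -/
theorem noParityTie_of_singleWellSymbol {a τ₀ : ℝ} (ha : 0 < a) (hτ₀ : 0 < τ₀) {σ : ℝ → ℝ}
    (hσ : IsWindowSymbol a σ) (heven : ∀ τ, σ (-τ) = σ τ)
    (hin : ∀ τ, |τ| < τ₀ → σ τ ≤ weilGroundEnergy a)
    (hout : ∀ τ, τ₀ < |τ| → weilGroundEnergy a ≤ σ τ)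
    (hin' : 0 < volume {τ : ℝ | |τ| < τ₀ ∧ σ τ < weilGroundEnergy a})
    (hout' : 0 < volume {τ : ℝ | τ₀ < |τ| ∧ weilGroundEnergy a < σ τ}) :
    weilEvenGroundEnergy a ≠ weilOddGroundEnergy a := by
  sorry

/-- The same criterion in the shape of the residue item `NoParityCrossing` (stmt-RiemannHypothesis-18085):
single-well representatives on every window beyond the one-prime window give the crux's RH-bearing half. -/
theorem noParityCrossing_of_singleWell
    (h : ∀ a : ℝ, Real.log 3 / 2 < a → ∃ τ₀ : ℝ, 0 < τ₀ ∧ ∃ σ : ℝ → ℝ, IsWindowSymbol a σ ∧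
      (∀ τ, σ (-τ) = σ τ) ∧ (∀ τ, |τ| < τ₀ → σ τ ≤ weilGroundEnergy a) ∧
      (∀ τ, τ₀ < |τ| → weilGroundEnergy a ≤ σ τ) ∧
      0 < volume {τ : ℝ | |τ| < τ₀ ∧ σ τ < weilGroundEnergy a} ∧
      0 < volume {τ : ℝ | τ₀ < |τ| ∧ weilGroundEnergy a < σ τ}) :
    ∀ a : ℝ, Real.log 3 / 2 < a → weilEvenGroundEnergy a ≠ weilOddGroundEnergy a := by
  intro a ha
  obtain ⟨τ₀, hτ₀, σ, hσ, hev, hin, hout, hin', hout'⟩ := h a ha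
  have ha0 : 0 < a := lt_trans (by positivity) ha
  exact noParityTie_of_singleWellSymbol ha0 hτ₀ hσ hev hin hout hin' hout'

/-! ## Card `loewner-displacement-central-zero`, stub K2 (edge non-vanishing): Hadamard flux identity + Grönwall glue
(the separate Hadamard–Grönwall line was examined and NOT filed: its RH-strength input is circular near a tie, see NOTES.md) -/

/-- Even-sector ground state of the window-`a` Weil form (the even twin of the tree's `IsWeilOddGroundState`:
an `L²` limit of a minimising sequence of EVEN normalised window tests for `weilEvenGroundEnergy a`). -/
def IsWeilEvenGroundState (a : ℝ) (u : ℝ → ℂ) : Prop :=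
  MemLp u 2 ∧ ∃ g : ℕ → ℝ → ℂ,
    (∀ n, IsWeilTest (g n) ∧ tsupport (g n) ⊆ Icc (-a) a ∧ (∀ t, g n (-t) = g n t) ∧
      ∫ t, ‖g n t‖ ^ 2 = (1 : ℝ)) ∧
    Filter.Tendsto (fun n ↦ (weilQuadratic (g n)).re) Filter.atTop (nhds (weilEvenGroundEnergy a)) ∧
    Filter.Tendsto (fun n ↦ ∫ t, ‖g n t - u t‖ ^ 2) Filter.atTop (nhds 0)

/-- **K2 first lemma (card `loewner-displacement-central-zero`): Hadamard flux identity for BOTH parity sectors with ONE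
constant.**  At a window where each sector bottom is attained by a ground state unique up to phase and having a left
edge limit, the sector bottoms are differentiable in the window and their derivatives are minus a common positive
multiple of the squared edge values (the log-kinetic analogue of `dλ/da = −|∂ₙu|²` / of the fractional Hadamard formula;
the constant comes from the `1/(2t)` singularity of Bombieri's kernel `e^{t/2}/(2 sinh t)` and does not see parity). -/
theorem hadamard_flux_parity :
    ∃ κ : ℝ → ℝ, (∀ a, 0 < a → 0 < κ a) ∧ ∀ a : ℝ, 0 < a →
      ∀ u o : ℝ → ℂ, IsWeilEvenGroundState a u → IsWeilOddGroundState a o →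
      (∀ v, IsWeilEvenGroundState a v → ∃ c : ℂ, ‖c‖ = 1 ∧ v =ᵐ[volume] fun t ↦ c * u t) →
      (∀ v, IsWeilOddGroundState a v → ∃ c : ℂ, ‖c‖ = 1 ∧ v =ᵐ[volume] fun t ↦ c * o t) →
      ∀ ℓe ℓo : ℂ, Filter.Tendsto u (nhdsWithin a (Iio a)) (nhds ℓe) →
        Filter.Tendsto o (nhdsWithin a (Iio a)) (nhds ℓo) →
        HasDerivAt weilEvenGroundEnergy (-(κ a) * ‖ℓe‖ ^ 2) a ∧
          HasDerivAt weilOddGroundEnergy (-(κ a) * ‖ℓo‖ ^ 2) a := by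
  sorry

/-- **Grönwall glue, pure real analysis (recorded for completeness):** a differentiable parity gap
`D = ε_od − ε_ev` that is positive at the anchor and satisfies `D′ ≥ −K·D` on every compact window range cannot vanish. -/
theorem noCrossing_of_gronwall {D : ℝ → ℝ} {a₀ : ℝ} (hD : ∀ a, a₀ ≤ a → DifferentiableAt ℝ D a)
    (h0 : 0 < D a₀)
    (hK : ∀ A, a₀ < A → ∃ K : ℝ, ∀ a, a₀ ≤ a → a ≤ A → -K * D a ≤ deriv D a) :
    ∀ a, a₀ ≤ a → 0 < D a := by
  sorry

end Summit.RiemannHypothesis.RiemannHypothesis.Cruxes.EvenWinsBeyondArch.IdeasK4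

end
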